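import Summits.BirchSwinnertonDyer.Rank1Residual.WAll.AltClosersAdditiveCells
import Summits.BirchSwinnertonDyer.Rank1Residual.X1.RankZeroDoubleTwistTransport
import Summits.BirchSwinnertonDyer.Rank1Residual.X1.RankOne
import Summits.BirchSwinnertonDyer.Rank1Residual.X1.KellerYinTheoremAClass
import Summits.BirchSwinnertonDyer.BirchSwinnertonDyer.Theorems.SchneiderWeakenLeaf
import Summits.BirchSwinnertonDyer.BirchSwinnertonDyer.Theorems.SignedSupersingularInputs
import Summits.BirchSwinnertonDyer.Rank1Residual.X12.CMRamifiedAdditive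
import HarnessLib

/-!
# Rung W-ALL (D-0120): ALT-CLOSERS BY NAME for the CELLS the wall's lane-3 routes cut out of rows 4,
# 7 and 12 — each route's deciding purchase, its RESIDUAL items (verbatim) and its SHARED items, closed
# from registered leaves / typed targets / named print facts (cell `bsd-wall`, lane 2, seat ty-2)

HONEST FRAMING (cell `bsd-wall`, run/shared/lean/pub/bsd-wall/; WALL-BRIEF-v1 §2; companion of
`WAll/AltClosers.lean`, `WAll/AltClosersGlue.lean`, `WAll/AltClosersAdditiveCells.lean`, same rules:
NOTHING ASSERTED, no `def`, no `@[conjecture]`, no named fact, NO ROUTE FILE IMPORTED — every module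
imported here is a `Rank1Residual/` kernel file or a `Theorems/` leaf file outside the Theses cone).
The lane-3 planners of the wall attack ONE conjunct of a row `Prop` each and declare the rest of the
row as RESIDUAL / SHARED items (planner.md BC6, the tribunal's conjunct-split reading). This file
re-types those cells VERBATIM (so a route's `closes` can feed its items in unchanged) and proves, by
name and with no mathematics beyond case splits:

| row | route sketch (seat) | cells of the row `Prop` | this file |
|---|---|---|---|
| 4 `WAllCornerX1` | `RealTwistEisenstein` (bsd-wall-eis) | rank-`0` leaf `X1.RankZero.Statement` ⇐ KY Thm. 3.0.8 at `𝟙` for the good lattice (`h308` = K5 crux 2 `GoodLatticeBDPValue`, item 19032) + the leaf rider `X1.RankZeroDoubleTwistTransport.DoubleTwistCertificateSupply` split into its BALANCED cell (the route's deciding purchase: cruxes `RealTwistEisensteinCriterion` + `RealTwistCriterionSupply`) and its UNBALANCED cell (the route's residual `UnbalancedRankZeroResidual`, verbatim) + PUB · rank-`1` type A ⇐ `h308` + PUB (Keller–Yin Theorem A, tree theorem `X1.KellerYinTheoremA.forall_bsdp_classX1_typeA_rankOne`) · rank-`1` type B = the REGISTERED rung-I1 leaf `SchneiderWeaken.TypeBRankOneUnridered`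 | `unbalancedRankZeroResidual_of_doubleTwistCertificateSupply`, `doubleTwistCertificateSupply_of_cells`, `doubleTwistCertificateSupply_iff_cells`, `x1RankZeroStatement_of_h308_of_certificateCells`, `x1RankOneStatement_of_typeA_of_typeBLeaf`, `wallCornerX1_of_x1Statements` (+ `bsdpOnClassX1_of_wallCornerX1`, `wallCornerX1_iff_x1Statements`: exact — a class-X1 pair is non-CM), `wallCornerX1_of_h308_of_certificateCells_of_typeBLeaf` |
| 7 `WAllCornerX7` | `SignedBaseChange` (bsd-wall-ss) | `p ≥ 5 ∧ Surj` in Kobayashi-main-conjecture currency (the route's deciding purchase: `TwistPairGreenbergProductDivisibility` + `SignedDescentFromGreenbergProduct`) · `p ≥ 5 ∧ ¬Surj` = item 19002 `KobayashiMainConjectureSmallImage` (SHARED with route `SignedLowerHalves`, verbatim) · `p = 3` = residual `CornerX7AtThree` (closed from leaf K3 by `cornerX7AtThree_of_signedSupersingular`, `AltClosersAdditiveCells.lean`) + PUB (Kobayashi 2003 Thm 1.2, Kim 2013 Cor 3.15, BKO Cor A.5, Pollack (tree theorem), modularity, GZK) | `kobayashiMC_classX7_fiveLe_of_surj_of_smallImage`,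 `cornerX7_fiveLe_of_kobayashiMC`, `wallCornerX7_of_surjKobayashiMC_of_smallImage_of_three`, `wallCornerX7_of_surjKobayashiMC_of_smallImage_of_signedSupersingular` |
| 12i `WAllCornerFInertBad` | `BiquadraticEisensteinDescent` (bsd-wall-cm) | `p ≥ 5` slice in `BSD(E,p)` currency (the route's deciding purchase `EisensteinDivisibilityCMInertBad` lives here) · `p = 3` = item 19225 `InertBadAtThree` of route `InertBadSignedBranches` (SHARED residual, verbatim, `Typed.X12.MissingInputAt` currency) ⇐ leaf K8-CM `X12.CMInertBad` | `inertBadAtThree_of_cmInertBad`, `cornerFInertBad_three_of_inertBadAtThree`, `wallCornerFInertBad_of_fiveLe_of_inertBadAtThree`, `slices_of_wallCornerFInertBad` |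

Row 1 (`NonCMAtTwo`, seat bsd-wall-p2) and row 2 (seat bsd-wall-add) are served by
`AltClosers.lean` (`nonCMAtTwo_of_reductionTypesAtTwo`) and `AltClosersAdditiveCells.lean` §3.

References: WALL-BRIEF-v1.md §2–§3; HOME/bsd-wall-eis/Sketch.lean (sha16 06633b27cf8952b3),
HOME/bsd-wall-ss/Sketch.lean (79ecd321a990c4b7), STATUS 03:46:15Z (bsd-wall-cm first crux);
`X1/RankZero.lean`, `X1/RankOne.lean`, `X1/RankZeroDoubleTwistTransport.lean`,
`X1/KellerYinTheoremAClass.lean`, `Theorems/SchneiderWeakenLeaf.lean`,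
`Supersingular/KobayashiMainConjectureX7.lean`, `Supersingular/SignedRankOneCorA5.lean`,
`Partition/MainConjecturesCMSupersingular.lean`, `X12/CMRungLeaves.lean`, `Typed/X12.lean`;
[cite: KellerYin2024, Thm. 3.0.8 (IMC2) and Thm. 4.2.1 (claim, under review)];
[cite: Kobayashi2003, Thm. 1.2, Thm. 4.1]; [cite: Wuthrich2014, Prop. 21 (p. 400)];
[cite: Miller2011LMS, §1 and Def. 1.1].
-/

noncomputable section

open scoped Classical

open WeierstrassCurve Literature.NumberTheory.EllipticCurves
  Literature.NumberTheory.EllipticCurves.Rank1Residual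
  Literature.NumberTheory.EllipticCurves.Rank1Residual.Typed
  Literature.NumberTheory.EllipticCurves.Wuthrich2014
  Literature.NumberTheory.EllipticCurves.ModularForms
  Literature.NumberTheory.EllipticCurves.CastellaGrossiLeeSkinner2022
  Literature.NumberTheory.EllipticCurves.KellerYin2024

set_option autoImplicit false

namespace Summit.BirchSwinnertonDyer.Rank1Residual.WAll

open Summit.BirchSwinnertonDyer
open Summit.BirchSwinnertonDyer.BirchSwinnertonDyer.Theorems.Rank1ResidualX1Defs (BSDpOnClassX1)
open Summit.BirchSwinnertonDyer.BirchSwinnertonDyer.Theorems.SchneiderWeaken (TypeBRankOneUnridered)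
open Summit.BirchSwinnertonDyer.Rank1Residual.X1.RankZeroDoubleTwist (DoubleTwistPartnerAt)
open Summit.BirchSwinnertonDyer.Rank1Residual.X1.RankZeroDoubleTwistTransport
  (DoubleTwistCertificateSupply)
open Summit.BirchSwinnertonDyer.Rank1Residual.Supersingular (KobayashiMainConjecture)

/-! ## §1 Row 4 (corner X1): the two X1 leaves, the certificate cells of the rank-`0` leaf rider,
and the row from `h308` + cells + the rung-I1 leaf + PUB -/

/-- **Row 4 is the two X1 leaf statements** (`X1.RankOne.bsdpOnClassX1_iff_statements` ∘
`wallCornerX1_of_bsdpOnClassX1`): `BSD(E,p)` on the rank-`0` leaf (`X1.RankZero.Statement`, ladder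
row A3) and on the rank-`1` leaf (`X1.RankOne.Statement`, rows A1 ⊔ A2). [folklore] -/
theorem wallCornerX1_of_x1Statements (h0 : X1.RankZero.Statement) (h1 : X1.RankOne.Statement) :
    WAllCornerX1 :=
  wallCornerX1_of_bsdpOnClassX1 (X1.RankOne.bsdpOnClassX1_iff_statements.mpr ⟨h0, h1⟩)

/-- **Conversely — row 4 is EXACTLY the typed class target `BSDpOnClassX1` (rung K5's X1 conjunct),
unconditionally**: a class-X1 pair is NON-CM, since a CM curve over `ℚ` has irreducible `E[p]` at
every odd prime of good reduction (`X12.not_red_of_hasCM_of_good`), so the `¬ W.HasCM` binder of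
`WAllCornerX1` is idle. [cite: Mazur1978, §6 Prop. 6.3 (1) (p. 153)] [cite: SilvermanAEC2009, Cor. VII.7.2] -/
theorem bsdpOnClassX1_of_wallCornerX1 (h : WAllCornerX1) : BSDpOnClassX1 := by
  intro W _ _ p _ hX hr
  by_cases hcm : W.HasCM
  · exact absurd hX.2.1 (X12.not_red_of_hasCM_of_good W p hcm (by have := hX.1; omega) hX.2.2.1)
  · exact h W p hcm hX hr

/-- **Row 4 ⟺ the two X1 leaf statements** (rank-`0` leaf `X1.RankZero.Statement`, rank-`1` leaf
`X1.RankOne.Statement`), unconditionally. [cite: Mazur1978, §6 Prop. 6.3 (1) (p. 153)] -/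
theorem wallCornerX1_iff_x1Statements :
    WAllCornerX1 ↔ X1.RankZero.Statement ∧ X1.RankOne.Statement :=
  ⟨fun h ↦ X1.RankOne.bsdpOnClassX1_iff_statements.mp (bsdpOnClassX1_of_wallCornerX1 h),
    fun h ↦ wallCornerX1_of_x1Statements h.1 h.2⟩

/-- **The rank-`1` leaf statement from its two parity cells**: type A (`¬ GVPar`; Keller–Yin
Theorem A's cell) and type B = the REGISTERED rung-I1 leaf `SchneiderWeaken.TypeBRankOneUnridered`
(`X1.TypeBRankOne W p := ClassX1 W p ∧ r = 1 ∧ GVPar W p`; `X1.RankOne.leaf_cases`). [folklore] -/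
theorem x1RankOneStatement_of_typeA_of_typeBLeaf
    (hA : ∀ (W : WeierstrassCurve ℚ) [W.IsElliptic] [W.IsGloballyMinimal] (p : ℕ) [Fact p.Prime],
      ClassX1 W p → ¬ GVPar W p → W.analyticRank = 1 → BSDp W p)
    (hB : TypeBRankOneUnridered) : X1.RankOne.Statement := by
  intro W _ _ p _ hL
  by_cases hgv : GVPar W p
  · exact hB W p ⟨hL.1, hL.2, hgv⟩
  · exact hA W p hL.1 hgv hL.2

/-- Conversely the two parity cells follow from the rank-`1` leaf statement (no loss). [folklore] -/
theorem typeA_typeBLeaf_of_x1RankOneStatement (h1 : X1.RankOne.Statement) :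
    (∀ (W : WeierstrassCurve ℚ) [W.IsElliptic] [W.IsGloballyMinimal] (p : ℕ) [Fact p.Prime],
      ClassX1 W p → ¬ GVPar W p → W.analyticRank = 1 → BSDp W p) ∧ TypeBRankOneUnridered :=
  ⟨fun W _ _ p _ hX _ hr1 ↦ h1 W p ⟨hX, hr1⟩, fun W _ _ p _ hB ↦ h1 W p ⟨hB.1, hB.2.1⟩⟩

/-- **The eis route's residual `UnbalancedRankZeroResidual` (VERBATIM) ⇐ the leaf rider of rung K5's
crux 5** (`X1.RankZeroDoubleTwistTransport.DoubleTwistCertificateSupply`: every rank-`0` X1 leaf pair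
carries the double-twist certificate `DoubleTwistPartnerAt`) — the residual is the rider RESTRICTED to
the complement of the balanced Mazur class (squarefree `N` and, on an isogenous curve, `p ∣ #tors`
with `ord_p ∏ c_ℓ = 1`), i.e. territory of route `EisensteinPrimes` item 19035, not a new claim.
[folklore] -/
theorem unbalancedRankZeroResidual_of_doubleTwistCertificateSupply (hC : DoubleTwistCertificateSupply) :
    ∀ (W : WeierstrassCurve ℚ) [W.IsElliptic] [W.IsGloballyMinimal] (p : ℕ) [Fact p.Prime],
      X1.RankZero.Leaf W p →
      ¬ (Squarefree (W.conductorNorm ℤ) ∧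
        ∃ (W' : WeierstrassCurve ℚ) (_ : W'.IsElliptic) (_ : W'.IsGloballyMinimal),
          IsIsogenous W W' ∧ p ∣ W'.torsionOrder ∧ padicValNat p W'.tamagawaProduct = 1) →
      DoubleTwistPartnerAt W p :=
  fun W _ _ p _ hL _ ↦ hC W p hL

/-- **The leaf rider from its two cells**: the BALANCED cell (the certificate on the balanced Mazur
class — what the eis route's cruxes `RealTwistEisensteinCriterion` + `RealTwistCriterionSupply`
purchase, its `closes` packaging the datum into `DoubleTwistPartnerAt`) and the UNBALANCED cell (the
route's residual `UnbalancedRankZeroResidual`, verbatim). [folklore] -/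
theorem doubleTwistCertificateSupply_of_cells
    (hBal : ∀ (W : WeierstrassCurve ℚ) [W.IsElliptic] [W.IsGloballyMinimal] (p : ℕ) [Fact p.Prime],
      X1.RankZero.Leaf W p →
      (Squarefree (W.conductorNorm ℤ) ∧
        ∃ (W' : WeierstrassCurve ℚ) (_ : W'.IsElliptic) (_ : W'.IsGloballyMinimal),
          IsIsogenous W W' ∧ p ∣ W'.torsionOrder ∧ padicValNat p W'.tamagawaProduct = 1) →
      DoubleTwistPartnerAt W p)
    (hUnb : ∀ (W : WeierstrassCurve ℚ) [W.IsElliptic] [W.IsGloballyMinimal] (p : ℕ) [Fact p.Prime],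
      X1.RankZero.Leaf W p →
      ¬ (Squarefree (W.conductorNorm ℤ) ∧
        ∃ (W' : WeierstrassCurve ℚ) (_ : W'.IsElliptic) (_ : W'.IsGloballyMinimal),
          IsIsogenous W W' ∧ p ∣ W'.torsionOrder ∧ padicValNat p W'.tamagawaProduct = 1) →
      DoubleTwistPartnerAt W p) :
    DoubleTwistCertificateSupply := by
  intro V _ _ p _ hL
  by_cases hB : (Squarefree (V.conductorNorm ℤ) ∧
      ∃ (W' : WeierstrassCurve ℚ) (_ : W'.IsElliptic) (_ : W'.IsGloballyMinimal),
        IsIsogenous V W' ∧ p ∣ W'.torsionOrder ∧ padicValNat p W'.tamagawaProduct = 1)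
  · exact hBal V p hL hB
  · exact hUnb V p hL hB

/-- **The leaf rider is EXACTLY its two cells** (no loss in the split). [folklore] -/
theorem doubleTwistCertificateSupply_iff_cells : DoubleTwistCertificateSupply ↔
    (∀ (W : WeierstrassCurve ℚ) [W.IsElliptic] [W.IsGloballyMinimal] (p : ℕ) [Fact p.Prime],
      X1.RankZero.Leaf W p →
      (Squarefree (W.conductorNorm ℤ) ∧
        ∃ (W' : WeierstrassCurve ℚ) (_ : W'.IsElliptic) (_ : W'.IsGloballyMinimal),
          IsIsogenous W W' ∧ p ∣ W'.torsionOrder ∧ padicValNat p W'.tamagawaProduct = 1) →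
      DoubleTwistPartnerAt W p) ∧
    (∀ (W : WeierstrassCurve ℚ) [W.IsElliptic] [W.IsGloballyMinimal] (p : ℕ) [Fact p.Prime],
      X1.RankZero.Leaf W p →
      ¬ (Squarefree (W.conductorNorm ℤ) ∧
        ∃ (W' : WeierstrassCurve ℚ) (_ : W'.IsElliptic) (_ : W'.IsGloballyMinimal),
          IsIsogenous W W' ∧ p ∣ W'.torsionOrder ∧ padicValNat p W'.tamagawaProduct = 1) →
      DoubleTwistPartnerAt W p) :=
  ⟨fun hC ↦ ⟨fun W _ _ p _ hL _ ↦ hC W p hL, unbalancedRankZeroResidual_of_doubleTwistCertificateSupply hC⟩,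
    fun h ↦ doubleTwistCertificateSupply_of_cells h.1 h.2⟩

/-- **The rank-`0` leaf statement `X1.RankZero.Statement` (ladder row A3) from `h308` (Keller–Yin
Thm. 3.0.8 (IMC2) at `𝟙` for the good lattice, PRE — the body of rung K5's crux 2 `GoodLatticeBDPValue`,
item 19032, = the eis route's support) + the two certificate cells + PUBLISHED facts** (CGLS 5.1.1
`h511`, Wuthrich Prop. 21 `hW`, Cassels `hCassels`, modularity `hmodP`/`hmod`, Gross–Zagier
`hGZQ`/`hGZ`, Kolyvagin `hKo`, GZK), through the kernel
`X1.RankZeroDoubleTwistTransport.statement_of_h308_of_certificateSupply` (Ribet's lemma supplies the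
good lattice internally). CONDITIONAL; nothing closed. [claim: KellerYin2024, status: under-review]
[cite: KellerYin2024, Thm. 3.0.8 (IMC2)] [cite: Wuthrich2014, Prop. 21 (p. 400)] -/
theorem x1RankZeroStatement_of_h308_of_certificateCells
    (h308 : thm308_imc2_bdpValue_goodLattice_OPEN)
    (hBal : ∀ (W : WeierstrassCurve ℚ) [W.IsElliptic] [W.IsGloballyMinimal] (p : ℕ) [Fact p.Prime],
      X1.RankZero.Leaf W p →
      (Squarefree (W.conductorNorm ℤ) ∧
        ∃ (W' : WeierstrassCurve ℚ) (_ : W'.IsElliptic) (_ : W'.IsGloballyMinimal),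
          IsIsogenous W W' ∧ p ∣ W'.torsionOrder ∧ padicValNat p W'.tamagawaProduct = 1) →
      DoubleTwistPartnerAt W p)
    (hUnb : ∀ (W : WeierstrassCurve ℚ) [W.IsElliptic] [W.IsGloballyMinimal] (p : ℕ) [Fact p.Prime],
      X1.RankZero.Leaf W p →
      ¬ (Squarefree (W.conductorNorm ℤ) ∧
        ∃ (W' : WeierstrassCurve ℚ) (_ : W'.IsElliptic) (_ : W'.IsGloballyMinimal),
          IsIsogenous W W' ∧ p ∣ W'.torsionOrder ∧ padicValNat p W'.tamagawaProduct = 1) →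
      DoubleTwistPartnerAt W p)
    (h511 : thm511_anticyclotomicControl_of_torsionFree)
    (hW : sha_dvd_analyticSha) (hCassels : bsdRHS_eq_of_isIsogenous)
    (hmodP : nonempty_modularParametrizationData) (hmod : exists_isNewformOf)
    (hGZQ : GrossZagier1986_thm_I_7_3)
    (hGZ : ∀ (N : ℕ) [NeZero N] (W : WeierstrassCurve ℚ) (K : Type) [Field K] [NumberField K],
      gross_zagier N W K)
    (hKo : ∀ (N : ℕ) [NeZero N] (W : WeierstrassCurve ℚ) (K : Type) [Field K] [NumberField K],
      kolyvagin N W K)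
    (hGZK : rank_eq_analyticRank_of_analyticRank_le_one) : X1.RankZero.Statement :=
  X1.RankZeroDoubleTwistTransport.statement_of_h308_of_certificateSupply h308
    (doubleTwistCertificateSupply_of_cells hBal hUnb) h511 hW hCassels hmodP hmod hGZQ hGZ hKo hGZK

/-- **ROW 4 `WAllCornerX1` FROM ITS CELLS, outside the Theses cone**: `h308` (K5 crux 2 = the eis
route's support `GoodLatticeBDPValue`) + the BALANCED certificate cell (the eis route's deciding
purchase) + the UNBALANCED cell (its residual `UnbalancedRankZeroResidual`, verbatim) + the registered
rung-I1 leaf `SchneiderWeaken.TypeBRankOneUnridered` (rank `1`, type B) + PUBLISHED facts; the rank-`1`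
type-A cell is Keller–Yin Theorem A from `h308` + PUB (`X1.KellerYinTheoremA.forall_bsdp_classX1_typeA_rankOne`,
tree theorem). (Inside the `EisensteinPrimes` cone the I1 leaf itself follows from `h308` + the
rank-`0` supply + PUB — `Theorems/SlopeDichotomyA2DegenerateLocusA2AnticyclotomicRoad.lean`,
`Theorems/EisensteinPrimesMazurMCOnX1RankZeroDoubleTwist.lean`; those modules import route files and
are cited here by name only.) CONDITIONAL; nothing closed. [claim: KellerYin2024, status: under-review]
[cite: KellerYin2024, Thm. 3.0.8 (IMC2) and Thm. 4.2.1] [cite: GreenbergVatsal2000, Thm. (1.3)]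
[cite: Wuthrich2014, Prop. 21 (p. 400)] -/
theorem wallCornerX1_of_h308_of_certificateCells_of_typeBLeaf
    (h308 : thm308_imc2_bdpValue_goodLattice_OPEN)
    (hBal : ∀ (W : WeierstrassCurve ℚ) [W.IsElliptic] [W.IsGloballyMinimal] (p : ℕ) [Fact p.Prime],
      X1.RankZero.Leaf W p →
      (Squarefree (W.conductorNorm ℤ) ∧
        ∃ (W' : WeierstrassCurve ℚ) (_ : W'.IsElliptic) (_ : W'.IsGloballyMinimal),
          IsIsogenous W W' ∧ p ∣ W'.torsionOrder ∧ padicValNat p W'.tamagawaProduct = 1) →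
      DoubleTwistPartnerAt W p)
    (hUnb : ∀ (W : WeierstrassCurve ℚ) [W.IsElliptic] [W.IsGloballyMinimal] (p : ℕ) [Fact p.Prime],
      X1.RankZero.Leaf W p →
      ¬ (Squarefree (W.conductorNorm ℤ) ∧
        ∃ (W' : WeierstrassCurve ℚ) (_ : W'.IsElliptic) (_ : W'.IsGloballyMinimal),
          IsIsogenous W W' ∧ p ∣ W'.torsionOrder ∧ padicValNat p W'.tamagawaProduct = 1) →
      DoubleTwistPartnerAt W p)
    (hB : TypeBRankOneUnridered)
    (h511 : thm511_anticyclotomicControl_of_torsionFree)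
    (hW : sha_dvd_analyticSha) (hCassels : bsdRHS_eq_of_isIsogenous)
    (hGV : GreenbergVatsal2000.thm13_charIdeal_eq_of_gvPar) (hGr : greenberg_charValue_rankZero)
    (hmodP : nonempty_modularParametrizationData) (hmod : exists_isNewformOf)
    (hHL : HoffsteinLuo1997_exists_twist_L_one_ne_zero) (hGZQ : GrossZagier1986_thm_I_7_3)
    (hGZ : ∀ (N : ℕ) [NeZero N] (W : WeierstrassCurve ℚ) (K : Type) [Field K] [NumberField K],
      gross_zagier N W K)
    (hKo : ∀ (N : ℕ) [NeZero N] (W : WeierstrassCurve ℚ) (K : Type) [Field K] [NumberField K],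
      kolyvagin N W K)
    (hGZK : rank_eq_analyticRank_of_analyticRank_le_one) : WAllCornerX1 :=
  wallCornerX1_of_x1Statements
    (x1RankZeroStatement_of_h308_of_certificateCells h308 hBal hUnb h511 hW hCassels hmodP hmod hGZQ
      hGZ hKo hGZK)
    (x1RankOneStatement_of_typeA_of_typeBLeaf
      (X1.KellerYinTheoremA.forall_bsdp_classX1_typeA_rankOne h308 h511 hCassels hGV hGr hmodP hmod
        hHL hGZQ hGZ hKo hGZK)
      hB)

/-! ## §2 Row 7 (corner X7): the surjective-image cell in Kobayashi-main-conjecture currency, the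
shared small-image item 19002, the `p = 3` residual, and the row from them + PUB -/

/-- **Kobayashi's main conjecture (some sign) at every non-CM X7 pair with `p ≥ 5`, from the two
image cells**: the SURJECTIVE cell (what the ss route's cruxes `TwistPairGreenbergProductDivisibility`
+ `SignedDescentFromGreenbergProduct` purchase: at `p ≥ 5`, `ClassX7`, `Surj`, Kobayashi's main
conjecture — they conclude it for every sign, a fortiori for some) and the SMALL-IMAGE cell = item
19002 `KobayashiMainConjectureSmallImage` of route `SignedLowerHalves` (SHARED, verbatim; `a_p = 0` is
automatic at `p ≥ 5` by Hasse, `Supersingular.ClassX7.frobeniusTrace_eq_zero_of_five_le`). [folklore] -/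
theorem kobayashiMC_classX7_fiveLe_of_surj_of_smallImage
    (hSurj : ∀ (W : WeierstrassCurve ℚ) [W.IsElliptic] [W.IsGloballyMinimal] (p : ℕ) [Fact p.Prime],
      5 ≤ p → ClassX7 W p → Surj W p → ∃ ε : ℤˣ, KobayashiMainConjecture W p ε)
    (hSmall : ∀ (W : WeierstrassCurve ℚ) [W.IsElliptic] [W.IsGloballyMinimal] (p : ℕ) [Fact p.Prime],
      p ≠ 2 → ClassX7 W p → ¬ W.HasCM → W.frobeniusTrace p = 0 → ¬ Surj W p →
        ∃ ε : ℤˣ, KobayashiMainConjecture W p ε) :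
    ∀ (W : WeierstrassCurve ℚ) [W.IsElliptic] [W.IsGloballyMinimal] (p : ℕ) [Fact p.Prime],
      5 ≤ p → ¬ W.HasCM → ClassX7 W p → ∃ ε : ℤˣ, KobayashiMainConjecture W p ε := by
  intro W _ _ p _ hp5 hcm hX
  by_cases hs : Surj W p
  · exact hSurj W p hp5 hX hs
  · exact hSmall W p (by omega) hX hcm
      (Supersingular.ClassX7.frobeniusTrace_eq_zero_of_five_le W p hp5 hX) hs

/-- **The `p ≥ 5` part of row 7 from Kobayashi's main conjecture on X7 (`p ≥ 5`, some sign) +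
PUBLISHED facts**, by the tree's image-free consumers: rank `0` —
`Supersingular.bsdp_of_kobayashiMainConjecture_of_analyticRank_eq_zero` (Kobayashi 2003 Thm 1.2
`h12`, Kim 2013 Cor 3.15 `hKim`, Pollack's `±` `p`-adic `L`-function — a tree THEOREM
`pollack_exists_plusMinusPAdicLFunction_holds` —, modularity `hmodP`/`hmod`, GZK; `E[p]` irreducible
by `ClassX7.irr`); rank `1` — `Supersingular.X7.bsdp_of_kobayashiMainConjecture_of_corA5_of_analyticRank_eq_one`
(Burungale–Kobayashi–Ota Cor. A.5 `hA5`, modularity, GZK). Mirrors the ss route's `closes`.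
[cite: Kobayashi2003, Thm. 1.2] [cite: BurungaleKobayashiOta2023, App. A Cor. A.5] -/
theorem cornerX7_fiveLe_of_kobayashiMC
    (hMC : ∀ (W : WeierstrassCurve ℚ) [W.IsElliptic] [W.IsGloballyMinimal] (p : ℕ) [Fact p.Prime],
      5 ≤ p → ¬ W.HasCM → ClassX7 W p → ∃ ε : ℤˣ, KobayashiMainConjecture W p ε)
    (h12 : Kobayashi2003.thm12_signedSelmerDual_finite_torsion)
    (hKim : BDKim2013.cor315_signedCharValue_rankZero)
    (hA5 : BurungaleKobayashiOta2024.corA5_pPart_of_signedCharIdeal_eq)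
    (hmodP : nonempty_modularParametrizationData) (hmod : hasEntireLFunction_rat)
    (hGZK : rank_eq_analyticRank_of_analyticRank_le_one) :
    ∀ (W : WeierstrassCurve ℚ) [W.IsElliptic] [W.IsGloballyMinimal] (p : ℕ) [Fact p.Prime],
      5 ≤ p → ¬ W.HasCM → ClassX7 W p → W.analyticRank ≤ 1 → BSDp W p := by
  intro W _ _ p _ hp5 hcm hX hr
  have hp2 : p ≠ 2 := by omega
  have hap : W.frobeniusTrace p = 0 :=
    Supersingular.ClassX7.frobeniusTrace_eq_zero_of_five_le W p hp5 hX
  obtain ⟨ε, hε⟩ := hMC W p hp5 hcm hX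
  rcases Nat.le_one_iff_eq_zero_or_eq_one.mp hr with h0 | h1
  · exact Supersingular.bsdp_of_kobayashiMainConjecture_of_analyticRank_eq_zero W p h12 hKim
      pollack_exists_plusMinusPAdicLFunction_holds hmodP hmod hGZK hp2 hX.1.1 hap
      (ClassX7.irr W p hp2 hX) h0 hε
  · exact Supersingular.X7.bsdp_of_kobayashiMainConjecture_of_corA5_of_analyticRank_eq_one W p hA5
      hmod hGZK hp2 hX hap h1 ε hε

/-- **ROW 7 `WAllCornerX7` FROM ITS CELLS, outside the Theses cone**: the surjective-image cell at
`p ≥ 5` in Kobayashi-main-conjecture currency (the ss route's deciding purchase) + item 19002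
(`KobayashiMainConjectureSmallImage`, SHARED, verbatim) + the `p = 3` residual `CornerX7AtThree`
(verbatim) + PUBLISHED facts (`wallCornerX7_of_three_of_fiveLe`). CONDITIONAL; nothing closed.
[cite: Kobayashi2003, Thm. 1.2] [cite: BurungaleKobayashiOta2023, App. A Cor. A.5] -/
theorem wallCornerX7_of_surjKobayashiMC_of_smallImage_of_three
    (hSurj : ∀ (W : WeierstrassCurve ℚ) [W.IsElliptic] [W.IsGloballyMinimal] (p : ℕ) [Fact p.Prime],
      5 ≤ p → ClassX7 W p → Surj W p → ∃ ε : ℤˣ, KobayashiMainConjecture W p ε)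
    (hSmall : ∀ (W : WeierstrassCurve ℚ) [W.IsElliptic] [W.IsGloballyMinimal] (p : ℕ) [Fact p.Prime],
      p ≠ 2 → ClassX7 W p → ¬ W.HasCM → W.frobeniusTrace p = 0 → ¬ Surj W p →
        ∃ ε : ℤˣ, KobayashiMainConjecture W p ε)
    (h3 : ∀ (W : WeierstrassCurve ℚ) [W.IsElliptic] [W.IsGloballyMinimal] (p : ℕ) [Fact p.Prime],
      p = 3 → ¬ W.HasCM → ClassX7 W p → W.analyticRank ≤ 1 → BSDp W p)
    (h12 : Kobayashi2003.thm12_signedSelmerDual_finite_torsion)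
    (hKim : BDKim2013.cor315_signedCharValue_rankZero)
    (hA5 : BurungaleKobayashiOta2024.corA5_pPart_of_signedCharIdeal_eq)
    (hmodP : nonempty_modularParametrizationData) (hmod : hasEntireLFunction_rat)
    (hGZK : rank_eq_analyticRank_of_analyticRank_le_one) : WAllCornerX7 :=
  wallCornerX7_of_three_of_fiveLe h3
    (cornerX7_fiveLe_of_kobayashiMC (kobayashiMC_classX7_fiveLe_of_surj_of_smallImage hSurj hSmall)
      h12 hKim hA5 hmodP hmod hGZK)

/-- **Row 7 with the `p = 3` residual fed from leaf K3** (`cornerX7AtThree_of_signedSupersingular`):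
the surjective cell + item 19002 + leaf K3 `Supersingular.SignedSupersingular` + PUB ⇒ `WAllCornerX7`.
CONDITIONAL; nothing closed. [cite: Kobayashi2003, Thm. 1.2] [cite: Wuthrich2014, Prop. 21 (p. 400)] -/
theorem wallCornerX7_of_surjKobayashiMC_of_smallImage_of_signedSupersingular
    (hSurj : ∀ (W : WeierstrassCurve ℚ) [W.IsElliptic] [W.IsGloballyMinimal] (p : ℕ) [Fact p.Prime],
      5 ≤ p → ClassX7 W p → Surj W p → ∃ ε : ℤˣ, KobayashiMainConjecture W p ε)
    (hSmall : ∀ (W : WeierstrassCurve ℚ) [W.IsElliptic] [W.IsGloballyMinimal] (p : ℕ) [Fact p.Prime],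
      p ≠ 2 → ClassX7 W p → ¬ W.HasCM → W.frobeniusTrace p = 0 → ¬ Surj W p →
        ∃ ε : ℤˣ, KobayashiMainConjecture W p ε)
    (hK3 : Supersingular.SignedSupersingular) (hWu : sha_dvd_analyticSha)
    (h12 : Kobayashi2003.thm12_signedSelmerDual_finite_torsion)
    (hKim : BDKim2013.cor315_signedCharValue_rankZero)
    (hA5 : BurungaleKobayashiOta2024.corA5_pPart_of_signedCharIdeal_eq)
    (hmodP : nonempty_modularParametrizationData) (hmod : hasEntireLFunction_rat)
    (hGZK : rank_eq_analyticRank_of_analyticRank_le_one) : WAllCornerX7 :=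
  wallCornerX7_of_surjKobayashiMC_of_smallImage_of_three hSurj hSmall
    (cornerX7AtThree_of_signedSupersingular hK3 hWu hGZK hmod) h12 hKim hA5 hmodP hmod hGZK

/-! ## §3 Row 12i (CM, `r = 1`, odd inert bad `p`): the `p = 3` item 19225 and the `p ≥ 5` slice -/

/-- **Item 19225 `InertBadAtThree` of route `InertBadSignedBranches` (= the cm route's shared
residual; VERBATIM, `Typed.X12.MissingInputAt` currency) ⇐ leaf K8-CM `X12.CMInertBad`** (its `p = 3`
instance). [folklore] -/
theorem inertBadAtThree_of_cmInertBad (h : X12.CMInertBad) :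
    ∀ (W : WeierstrassCurve ℚ) [W.IsElliptic] [W.IsGloballyMinimal] [Fact (Nat.Prime 3)],
      W.HasCM → W.analyticRank = 1 → CMInert W 3 → ¬ Good W 3 → X12.MissingInputAt W 3 :=
  fun W _ _ _ hcm hr1 hin hng ↦ h W 3 hcm hr1 (by decide) hin hng

/-- **The `p = 3` slice of row 12i in `BSD(E,p)` currency from item 19225 + Li–Liu–Tian + GZK**
(`X12.bsdp_of_missingInputAt`; the pair is a `CornerF`, hence a class-X12, pair). [folklore] -/
theorem cornerFInertBad_three_of_inertBadAtThree (hLLT : LiLiuTian2024.thm11_bsdp_of_cm_rank_one)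
    (hGZK : rank_eq_analyticRank_of_analyticRank_le_one)
    (h3 : ∀ (W : WeierstrassCurve ℚ) [W.IsElliptic] [W.IsGloballyMinimal] [Fact (Nat.Prime 3)],
      W.HasCM → W.analyticRank = 1 → CMInert W 3 → ¬ Good W 3 → X12.MissingInputAt W 3) :
    ∀ (W : WeierstrassCurve ℚ) [W.IsElliptic] [W.IsGloballyMinimal] (p : ℕ) [Fact p.Prime],
      p = 3 → W.HasCM → W.analyticRank = 1 → CMInert W p → ¬ Good W p → BSDp W p := by
  intro W _ _ p _ hp3 hcm hr1 hin hng
  subst hp3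
  exact X12.bsdp_of_missingInputAt hLLT hGZK W 3 (by rw [hr1])
    (cornerF_classX12 ⟨hcm, hr1, Or.inr ⟨hin.2, hng⟩⟩) (h3 W hcm hr1 hin hng)

/-- **ROW 12i `WAllCornerFInertBad` FROM ITS PRIME SLICES**: the `p ≥ 5` slice in `BSD(E,p)`
currency (where the cm route's deciding crux `EisensteinDivisibilityCMInertBad` and its Manin datum
live) + item 19225 (`p = 3`, SHARED residual, verbatim) + Li–Liu–Tian + GZK. An odd prime is `3` or
`≥ 5` (`Nat.Prime.five_le_of_ne_two_of_ne_three`). [folklore] -/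
theorem wallCornerFInertBad_of_fiveLe_of_inertBadAtThree
    (hLLT : LiLiuTian2024.thm11_bsdp_of_cm_rank_one)
    (hGZK : rank_eq_analyticRank_of_analyticRank_le_one)
    (h5 : ∀ (W : WeierstrassCurve ℚ) [W.IsElliptic] [W.IsGloballyMinimal] (p : ℕ) [Fact p.Prime],
      5 ≤ p → W.HasCM → W.analyticRank = 1 → CMInert W p → ¬ Good W p → BSDp W p)
    (h3 : ∀ (W : WeierstrassCurve ℚ) [W.IsElliptic] [W.IsGloballyMinimal] [Fact (Nat.Prime 3)],
      W.HasCM → W.analyticRank = 1 → CMInert W 3 → ¬ Good W 3 → X12.MissingInputAt W 3) :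
    WAllCornerFInertBad := by
  intro W _ _ p _ hcm hr1 hp2 hin hng
  by_cases hp3 : p = 3
  · exact cornerFInertBad_three_of_inertBadAtThree hLLT hGZK h3 W p hp3 hcm hr1 hin hng
  · exact h5 W p ((Fact.out : p.Prime).five_le_of_ne_two_of_ne_three hp2 hp3) hcm hr1 hin hng

/-- **Exactness of the prime split of row 12i**: the `p ≥ 5` slice and item 19225 both follow from
`WAllCornerFInertBad` (GZK gives `Ш` finite, so `BSD(E,3)` yields the typed missing `p`-part
`MissingPPartAt`, a fortiori `X12.MissingInputAt`). [folklore] -/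
theorem slices_of_wallCornerFInertBad (hGZK : rank_eq_analyticRank_of_analyticRank_le_one)
    (h : WAllCornerFInertBad) :
    (∀ (W : WeierstrassCurve ℚ) [W.IsElliptic] [W.IsGloballyMinimal] (p : ℕ) [Fact p.Prime],
      5 ≤ p → W.HasCM → W.analyticRank = 1 → CMInert W p → ¬ Good W p → BSDp W p) ∧
    (∀ (W : WeierstrassCurve ℚ) [W.IsElliptic] [W.IsGloballyMinimal] [Fact (Nat.Prime 3)],
      W.HasCM → W.analyticRank = 1 → CMInert W 3 → ¬ Good W 3 → X12.MissingInputAt W 3) := by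
  refine ⟨fun W _ _ p _ hp5 hcm hr1 hin hng ↦ h W p hcm hr1 (by omega) hin hng,
    fun W _ _ _ hcm hr1 hin hng _ ↦ ?_⟩
  haveI : Finite W.sha := (hGZK W (by rw [hr1])).2
  exact missingPPartAt_of_bsdp W 3 (h W 3 hcm hr1 (by decide) hin hng)

end Summit.BirchSwinnertonDyer.Rank1Residual.WAll

end
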